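import Summits.QuantumFields.YangMills.Theorems.AllWindowsColdBoxBoxHighLineCubeShellSums

/-!
# T-S5.8b `CubeTwoCentreSums` — two-centre convolution sums of the `(1+d)⁻²` / `(1+d)⁻⁴` kernels over the cube `[0,N]⁴`
# (STUB-PLAN-S5-STEP2 §5, planner ym-idea-2 g18; LINE-19 S5 ⟨stmt-QuantumFields-24004⟩/⟨24335⟩, LINE-20 U5 ⟨24336⟩; Props from ✓`…Step2Kernels` BY NAME)

Width seat `ym-line-sfw-p2-w4` (prover-ym-line-sfw-p2-w4-g27-0).  Given the one-centre shell sums T-S5.8a `CubeShellSums` (only its clause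
`Σ_p (1 + d(p,x))⁻⁴ ≤ C(1 + log N)`, any centre `x ∈ ℤ⁴`), the three two-centre sums follow from POINTWISE domination — no shell counting, no regions:
* `siteDist_triangle` — `d(x,y) ≤ d(p,x) + d(p,y)` for the sup-distance `siteDist` (per coordinate, `ciSup`);
* (2,2): `a⁻²b⁻² ≤ (a⁻⁴ + b⁻⁴)/2`;  (2,4): `a⁻²b⁻⁴ ≤ 4D⁻²(a⁻⁴ + 2b⁻⁴)`;  (4,4): `a⁻⁴b⁻⁴ ≤ 16D⁻⁴(a⁻⁴ + b⁻⁴)` whenever `1 ≤ a, b, D` and `D ≤ a + b`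
  (`a = 1 + d(p,x)`, `b = 1 + d(p,y)`, `D = 1 + d(x,y)`: one of the two centres is at distance `≥ d(x,y)/2` from `p`);
* **`cubeTwoCentreSums_of (hS : CubeShellSums) : CubeTwoCentreSums`** with constant `32·max(C,0)`, and the registered obligation BY NAME
  **`cubeTwoCentreSums : CubeTwoCentreSums`** over w5's ✓`cubeShellSums` (T-S5.8a, `…CubeShellSums`).

Everything proved; no definitions; standard axioms.  HONEST LABEL: an S-sized kernel brick of STEP 2 of the XL stub S5 of a
critic-PASSed DRAFT line on the R2ξ″ cruxes; S5, U5 and the items ⟨24004⟩ ⟨24335⟩ ⟨24336⟩ remain OPEN; no stub is closed by name, no crux, rung or summit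
is proved; the Yang–Mills mass gap is NOT proved by this file.
-/

set_option autoImplicit false

open Real Finset
open Literature.Probability.LatticeModels (Site)

namespace Summit.QuantumFields.YangMills.Theorems.AllWindowsColdBoxBoxHighLine

namespace CubeTwoCentre

/-! ## The sup-distance -/

/-- Each coordinate difference is at most the sup-distance. -/
theorem abs_sub_le_siteDist (x y : Site 4) (k : Fin 4) : |((x k - y k : ℤ) : ℝ)| ≤ siteDist x y :=
  le_ciSup (f := fun k : Fin 4 => |((x k - y k : ℤ) : ℝ)|) (Set.finite_range _).bddAbove k

/-- A common bound on the coordinate differences bounds the sup-distance. -/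
theorem siteDist_le_of_forall (x y : Site 4) {r : ℝ} (h : ∀ k : Fin 4, |((x k - y k : ℤ) : ℝ)| ≤ r) : siteDist x y ≤ r :=
  ciSup_le h

/-- **Triangle inequality** for the sup-distance, through a third point. -/
theorem siteDist_triangle (p x y : Site 4) : siteDist x y ≤ siteDist p x + siteDist p y := by
  refine siteDist_le_of_forall x y fun k => ?_
  have h1 := abs_sub_le_siteDist p x k
  have h2 := abs_sub_le_siteDist p y k
  have he : ((x k - y k : ℤ) : ℝ) = ((p k - y k : ℤ) : ℝ) - ((p k - x k : ℤ) : ℝ) := by push_cast; ring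
  rw [he]
  calc |((p k - y k : ℤ) : ℝ) - ((p k - x k : ℤ) : ℝ)| ≤ |((p k - y k : ℤ) : ℝ)| + |((p k - x k : ℤ) : ℝ)| := abs_sub _ _
    _ ≤ siteDist p y + siteDist p x := add_le_add h2 h1
    _ = siteDist p x + siteDist p y := add_comm _ _

/-! ## The three pointwise inequalities -/

/-- (2,2): `1/(a²b²) ≤ (1/a⁴ + 1/b⁴)/2`. -/
theorem pointwise_two_two {a b : ℝ} (ha : 0 < a) (hb : 0 < b) : 1 / (a ^ 2 * b ^ 2) ≤ (1 / a ^ 4 + 1 / b ^ 4) / 2 := by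
  rw [div_add_div _ _ (by positivity) (by positivity), div_div, div_le_div_iff₀ (by positivity) (by positivity)]
  nlinarith [sq_nonneg (a ^ 2 - b ^ 2), mul_pos (pow_pos ha 2) (pow_pos hb 2), pow_pos ha 4, pow_pos hb 4,
    mul_nonneg (sq_nonneg (a ^ 2 - b ^ 2)) (le_of_lt (mul_pos (pow_pos ha 2) (pow_pos hb 2)))]

/-- (2,4): `1/(a²b⁴) ≤ (4/D²)(1/a⁴ + 2/b⁴)` when `D ≤ a + b` (`a, b, D > 0`). -/
theorem pointwise_two_four {a b D : ℝ} (ha : 0 < a) (hb : 0 < b) (hD : 0 < D) (hDab : D ≤ a + b) :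
    1 / (a ^ 2 * b ^ 4) ≤ 4 / D ^ 2 * (1 / a ^ 4 + 2 / b ^ 4) := by
  have key : D ^ 2 * a ^ 2 ≤ 8 * a ^ 4 + 4 * b ^ 4 := by
    by_cases h : D ≤ 2 * b
    · have h1 : D ^ 2 ≤ 4 * b ^ 2 := by nlinarith
      nlinarith [sq_nonneg (a ^ 2 - b ^ 2), mul_le_mul_of_nonneg_right h1 (sq_nonneg a)]
    · have h1 : D ≤ 2 * a := by linarith
      have h2 : D ^ 2 ≤ 4 * a ^ 2 := by nlinarith
      nlinarith [mul_le_mul_of_nonneg_right h2 (sq_nonneg a), pow_nonneg hb.le 4]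
  have he : 4 / D ^ 2 * (1 / a ^ 4 + 2 / b ^ 4) = (4 * b ^ 4 + 8 * a ^ 4) / (D ^ 2 * a ^ 4 * b ^ 4) := by
    field_simp
    ring
  rw [he, div_le_div_iff₀ (by positivity) (by positivity)]
  nlinarith [mul_le_mul_of_nonneg_right key (by positivity : (0 : ℝ) ≤ a ^ 2 * b ^ 4)]

/-- (4,4): `1/(a⁴b⁴) ≤ (16/D⁴)(1/a⁴ + 1/b⁴)` when `D ≤ a + b` (`a, b, D > 0`). -/
theorem pointwise_four_four {a b D : ℝ} (ha : 0 < a) (hb : 0 < b) (hD : 0 < D) (hDab : D ≤ a + b) :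
    1 / (a ^ 4 * b ^ 4) ≤ 16 / D ^ 4 * (1 / a ^ 4 + 1 / b ^ 4) := by
  have key : D ^ 4 ≤ 16 * (a ^ 4 + b ^ 4) := by
    have h1 : D ^ 4 ≤ (a + b) ^ 4 := pow_le_pow_left₀ hD.le hDab 4
    nlinarith [mul_nonneg (sq_nonneg (a - b)) (by positivity : (0 : ℝ) ≤ 7 * a ^ 2 + 10 * a * b + 7 * b ^ 2), pow_nonneg ha.le 4, pow_nonneg hb.le 4]
  have he : 16 / D ^ 4 * (1 / a ^ 4 + 1 / b ^ 4) = (16 * (b ^ 4 + a ^ 4)) / (D ^ 4 * a ^ 4 * b ^ 4) := by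
    field_simp
  rw [he, div_le_div_iff₀ (by positivity) (by positivity)]
  nlinarith [mul_le_mul_of_nonneg_right key (by positivity : (0 : ℝ) ≤ a ^ 4 * b ^ 4)]

end CubeTwoCentre

open CubeTwoCentre GhostKernel

/-! ## T-S5.8b from T-S5.8a -/

/-- **T-S5.8b `CubeTwoCentreSums` from T-S5.8a `CubeShellSums`** (only the `(1+d)⁻⁴` one-centre sum is used; constant `32·max(C,0)`). -/
theorem cubeTwoCentreSums_of (hS : CubeShellSums) : CubeTwoCentreSums := by
  obtain ⟨C, hC⟩ := hS
  set C₀ := max C 0 with hC₀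
  have hC0 : 0 ≤ C₀ := le_max_right _ _
  have hCC : C ≤ C₀ := le_max_left _ _
  refine ⟨32 * C₀, fun N hN x y => ?_⟩
  have hN' : (1 : ℝ) ≤ N := by exact_mod_cast hN
  have hlog : 0 ≤ 1 + Real.log N := by have := Real.log_nonneg hN'; linarith
  -- the one-centre `(1+d)⁻⁴` sums
  have hS4 : ∀ z : Site 4, ∑ p ∈ cubeSites N, 1 / (1 + siteDist p z) ^ 4 ≤ C₀ * (1 + Real.log N) := fun z =>
    ((hC N hN z).2.1).trans (mul_le_mul_of_nonneg_right hCC hlog)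
  -- abbreviations
  have ha : ∀ p : Site 4, 0 < 1 + siteDist p x := fun p => by have := siteDist_nonneg p x; linarith
  have hb : ∀ p : Site 4, 0 < 1 + siteDist p y := fun p => by have := siteDist_nonneg p y; linarith
  have hD : 0 < 1 + siteDist x y := by have := siteDist_nonneg x y; linarith
  have hDab : ∀ p : Site 4, 1 + siteDist x y ≤ (1 + siteDist p x) + (1 + siteDist p y) := fun p => by
    have := siteDist_triangle p x y; linarith
  refine ⟨?_, ?_, ?_⟩
  · -- (2,2)
    calc ∑ p ∈ cubeSites N, 1 / ((1 + siteDist p x) ^ 2 * (1 + siteDist p y) ^ 2)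
        ≤ ∑ p ∈ cubeSites N, (1 / (1 + siteDist p x) ^ 4 + 1 / (1 + siteDist p y) ^ 4) / 2 :=
          Finset.sum_le_sum fun p _ => pointwise_two_two (ha p) (hb p)
      _ = ((∑ p ∈ cubeSites N, 1 / (1 + siteDist p x) ^ 4) + ∑ p ∈ cubeSites N, 1 / (1 + siteDist p y) ^ 4) / 2 := by
          rw [← Finset.sum_div, Finset.sum_add_distrib]
      _ ≤ (C₀ * (1 + Real.log N) + C₀ * (1 + Real.log N)) / 2 := by gcongr <;> exact hS4 _
      _ ≤ 32 * C₀ * (1 + Real.log N) := by nlinarith [mul_nonneg hC0 hlog]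
  · -- (2,4)
    calc ∑ p ∈ cubeSites N, 1 / ((1 + siteDist p x) ^ 2 * (1 + siteDist p y) ^ 4)
        ≤ ∑ p ∈ cubeSites N, 4 / (1 + siteDist x y) ^ 2 * (1 / (1 + siteDist p x) ^ 4 + 2 / (1 + siteDist p y) ^ 4) :=
          Finset.sum_le_sum fun p _ => pointwise_two_four (ha p) (hb p) hD (hDab p)
      _ = 4 / (1 + siteDist x y) ^ 2 *
            ((∑ p ∈ cubeSites N, 1 / (1 + siteDist p x) ^ 4) + 2 * ∑ p ∈ cubeSites N, 1 / (1 + siteDist p y) ^ 4) := by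
          rw [← Finset.mul_sum, Finset.sum_add_distrib, Finset.mul_sum]
          congr 1; congr 1
          exact Finset.sum_congr rfl fun p _ => by ring
      _ ≤ 4 / (1 + siteDist x y) ^ 2 * (C₀ * (1 + Real.log N) + 2 * (C₀ * (1 + Real.log N))) := by
          gcongr
          · exact hS4 _
          · exact hS4 _
      _ = 12 * C₀ * (1 + Real.log N) / (1 + siteDist x y) ^ 2 := by ring
      _ ≤ 32 * C₀ * (1 + Real.log N) / (1 + siteDist x y) ^ 2 := by
          gcongr
          nlinarith [mul_nonneg hC0 hlog]
  · -- (4,4)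
    calc ∑ p ∈ cubeSites N, 1 / ((1 + siteDist p x) ^ 4 * (1 + siteDist p y) ^ 4)
        ≤ ∑ p ∈ cubeSites N, 16 / (1 + siteDist x y) ^ 4 * (1 / (1 + siteDist p x) ^ 4 + 1 / (1 + siteDist p y) ^ 4) :=
          Finset.sum_le_sum fun p _ => pointwise_four_four (ha p) (hb p) hD (hDab p)
      _ = 16 / (1 + siteDist x y) ^ 4 *
            ((∑ p ∈ cubeSites N, 1 / (1 + siteDist p x) ^ 4) + ∑ p ∈ cubeSites N, 1 / (1 + siteDist p y) ^ 4) := by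
          rw [← Finset.mul_sum, Finset.sum_add_distrib]
      _ ≤ 16 / (1 + siteDist x y) ^ 4 * (C₀ * (1 + Real.log N) + C₀ * (1 + Real.log N)) := by
          gcongr <;> exact hS4 _
      _ = 32 * C₀ * (1 + Real.log N) / (1 + siteDist x y) ^ 4 := by ring

/-- **T-S5.8b `CubeTwoCentreSums` BY NAME** (over ✓T-S5.8a `cubeShellSums`). -/
theorem cubeTwoCentreSums : CubeTwoCentreSums :=
  cubeTwoCentreSums_of cubeShellSums

end Summit.QuantumFields.YangMills.Theorems.AllWindowsColdBoxBoxHighLine
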